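import Mathlib

/-!
# T5HalfPlaneIdentity — the identity principle on a half-plane: a holomorphic function on
`{Re s > r}` that agrees with another one on a smaller half-plane agrees on the whole of it,
kernel-checked

Support for `route/T5-N4-p5.md` (sub-step N4.3 = (R3)), step (N4.3.P1): «this half-plane contains the
region `Re s ≫ 0` in which [PS-R87]'s integral defines `Z_{τ′_j}(s)` (R3.1), so on `Re s ≥ 1/2` the
integral IS the meromorphic continuation, in particular at `s = 1/2`».  The analytic content of that
sentence: two functions holomorphic on the open half-plane `H_r = {Re s > r}` which coincide on
`{Re s > R}` (for some `R ≥ r`) coincide on all of `H_r` — the identity principle on a connected open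
set (Mathlib `AnalyticOnNhd.eqOn_of_preconnected_of_eventuallyEq`, `DifferentiableOn.analyticOnNhd`,
half-planes are convex hence preconnected).

* `isOpen_halfPlane`, `isPreconnected_halfPlane`;
* `eqOn_halfPlane_of_eqOn_subHalfPlane`: `DifferentiableOn ℂ f H_r`, `DifferentiableOn ℂ g H_r`,
  `EqOn f g H_R` with `r ≤ R` ⇒ `EqOn f g H_r`;
* `eq_at_of_eqOn_subHalfPlane`: in particular `f s = g s` at every `s` with `Re s > r` — e.g. at
  `s = 1/2` for `r = 1/2 − ε`.

Honest scope: the continuation `Z_{τ′_j}(s)` of (R3.1) and the integral representation for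
`Re s ≫ 0` are the text's [C] inputs; this file is the identity principle only.
-/

namespace Summit.Ventures.HodgeRepro2.T5HalfPlaneIdentity

open Set Filter Topology

/-- The open half-plane `{Re s > r}` is open. -/
theorem isOpen_halfPlane (r : ℝ) : IsOpen {s : ℂ | r < s.re} :=
  isOpen_lt continuous_const Complex.continuous_re

/-- The open half-plane `{Re s > r}` is preconnected (it is convex). -/
theorem isPreconnected_halfPlane (r : ℝ) : IsPreconnected {s : ℂ | r < s.re} :=
  (convex_halfSpace_re_gt r).isPreconnected

/-- A point of the smaller half-plane `{Re s > R}` has a neighbourhood on which two functions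
agreeing on `{Re s > R}` agree. -/
theorem eventuallyEq_of_eqOn_subHalfPlane {f g : ℂ → ℂ} {R : ℝ} (h : EqOn f g {s : ℂ | R < s.re})
    {z₀ : ℂ} (hz₀ : R < z₀.re) : f =ᶠ[𝓝 z₀] g :=
  Filter.eventuallyEq_of_mem ((isOpen_halfPlane R).mem_nhds hz₀) h

/-- THE IDENTITY PRINCIPLE ON A HALF-PLANE: if `f` and `g` are holomorphic on `{Re s > r}` and agree
on `{Re s > R}` for some `R ≥ r`, they agree on all of `{Re s > r}`. -/
theorem eqOn_halfPlane_of_eqOn_subHalfPlane {f g : ℂ → ℂ} {r R : ℝ} (hrR : r ≤ R)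
    (hf : DifferentiableOn ℂ f {s : ℂ | r < s.re}) (hg : DifferentiableOn ℂ g {s : ℂ | r < s.re})
    (h : EqOn f g {s : ℂ | R < s.re}) : EqOn f g {s : ℂ | r < s.re} := by
  have hfa : AnalyticOnNhd ℂ f {s : ℂ | r < s.re} := hf.analyticOnNhd (isOpen_halfPlane r)
  have hga : AnalyticOnNhd ℂ g {s : ℂ | r < s.re} := hg.analyticOnNhd (isOpen_halfPlane r)
  -- the point `z₀ = R + 1` lies in both half-planes
  have hz₀ : ((R + 1 : ℝ) : ℂ) ∈ {s : ℂ | r < s.re} := by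
    simp only [mem_setOf_eq, Complex.ofReal_re]; linarith
  have hz₀' : R < ((R + 1 : ℝ) : ℂ).re := by simp
  exact hfa.eqOn_of_preconnected_of_eventuallyEq hga (isPreconnected_halfPlane r) hz₀
    (eventuallyEq_of_eqOn_subHalfPlane h hz₀')

/-- In particular the two functions agree at every point `s` with `Re s > r` — e.g. at `s = 1/2`
when `r = 1/2 − ε`: the absolutely convergent integral on `{Re s > 1/2 − ε}` IS the continuation
there. -/
theorem eq_at_of_eqOn_subHalfPlane {f g : ℂ → ℂ} {r R : ℝ} (hrR : r ≤ R)
    (hf : DifferentiableOn ℂ f {s : ℂ | r < s.re}) (hg : DifferentiableOn ℂ g {s : ℂ | r < s.re})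
    (h : EqOn f g {s : ℂ | R < s.re}) {s : ℂ} (hs : r < s.re) : f s = g s :=
  eqOn_halfPlane_of_eqOn_subHalfPlane hrR hf hg h hs

/-- The instance of (N4.3.P1): `r = 1/2 − ε` with `ε > 0`, evaluation at `s = 1/2`. -/
theorem eq_at_half_of_eqOn_subHalfPlane {f g : ℂ → ℂ} {ε R : ℝ} (hε : 0 < ε) (hR : 1 / 2 - ε ≤ R)
    (hf : DifferentiableOn ℂ f {s : ℂ | 1 / 2 - ε < s.re})
    (hg : DifferentiableOn ℂ g {s : ℂ | 1 / 2 - ε < s.re})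
    (h : EqOn f g {s : ℂ | R < s.re}) : f (1 / 2) = g (1 / 2) := by
  refine eq_at_of_eqOn_subHalfPlane hR hf hg h ?_
  simp only [Complex.div_ofNat_re, Complex.one_re]
  linarith

end Summit.Ventures.HodgeRepro2.T5HalfPlaneIdentity
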